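import Literature.NumberTheory.EllipticCurves.Tian2014.CongruentNumbersHeegnerPoints
import Literature.NumberTheory.EllipticCurves.Smith2016.CongruentNumberBSDSelmerRankTwoProofs
import HarnessLib

/-!
# Wang 2016 (Sci. China Math. 59), *Congruent elliptic curves with non-trivial Shafarevich–Tate groups*, Thm. 3 AS PRINTED — rank `0` and `Ш(E_n/ℚ)[2^∞] ≅ (ℤ/2)²` on an explicit, decidable family of congruent number curves; and the door to the FULL BSD formula through Burungale–Tian 2026 + Burungale–Flach 2024

HONEST FRAMING (cell `b2b-bsdres`, sub-lane `bsd-p2`, Monsky sub-cell `p2/monsky/`, literature seat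
`p2-monsky-lit`, lead ask L1-6 / M-C3 "door D-CM-3"): ONE published theorem vendored as a named `Prop`
(nothing asserted, nothing discharged; D-0014), every printed hypothesis a binder, locators into the
held text; plus bookkeeping PROVED from tree theorems. It is EVIDENCE of what print says `2`-adically
for an explicit sub-family of the congruent number curves with `2`-Selmer rank `s(n) = 2` and
Mordell–Weil rank `0`; nothing booked; no mark moved.

Source. Z. Wang, *Congruent elliptic curves with non-trivial Shafarevich–Tate groups*, Sci. China
Math. **59** (2016), no. 11, 2145–2166, doi:10.1007/s11425-015-0741-3 [Wang2016CongruentSha]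
(JOURNAL). Text read: the held LaTeX-derived text `paper:arxiv-1511.03810` (chunks `p0001`–`p0016`;
locators `chunk:line`).

## The printed statements (verbatim)

* Setting (p0003 L12–L14, p0004 L3): `E_n : y² = x³ − n²x`, `n` a positive square-free integer;
  `𝒜_n` = the ideal class group of `K = ℚ(√−n)`; "We define the `2^i`-rank `h_{2^i}(n)` of `ℚ(√−n)`
  by `rank_{𝔽₂} 2^{i−1}𝒜_n/2^i𝒜_n` for `i ≥ 1`. Then we have `h₄(n) = rank_{𝔽₂} 𝒜_n[2] ∩ 2𝒜_n`."
* (p0003 L31–L33, strategy of proof of Thm. 1, for the `n` considered there) "a necessary condition of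
  (ii) holds is `s₂(n) = 2`, where `s₂(n)` is the pure `2`-Selmer rank given by
  `rank_{𝔽₂} Sel₂(E_n)/E_n[2](ℚ)`. By Monsky matrix (2.1) and Rédei matrix (3.1), we deduce that
  `s₂(n) = 2` is equivalent to `h₄(n) = 1`."
* **Theorem 3** (p0011 L107–L131): "For `p ≡ 1 (mod 8)` a prime, then there exists positive integers
  such that: `p = u² + 8v² = a² + 16b² = x² − 32y²`. Then the following are equivalent: (1) `2 ∤ v`;
  (2) `2 ∤ (p−1)/8 + b`; (3) `1 + i_p` is not a `p`-adic square with `i_p ∈ ℚ_p` such that `i_p² = −1`;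
  (4) `1 + j_p` is not a `p`-adic square with `j_p ∈ ℚ_p` such that `j_p² = 2`;
  (5) `(2/p)₄ = (−1)^{(p−9)/8}`; (6) `x ≡ 3 (mod 4)`; (7) `h₈(p) = 0`. And we define `δ_p = 1` if `p`
  satisfies the above equivalent conditions, else `δ_p = 0`. For `n` a square-free positive integer
  with all prime factors congruent to `1 (mod 8)` and `h₄(n) = 1`, the following are equivalent:
  (i) `2 ∤ δ_n := Σ_{p ∣ n} δ_p`; (ii) `h₈(n) = 0`;
  (iii) `rank_ℤ E_n(ℚ) = 0`, `Ш(E_n/ℚ)[2^∞] ≃ (ℤ/2ℤ)²`."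
* Thm. 1 (p0003 L18–L23; `n ≡ 1 (8)`, primes `≡ 1 (4)`, `h₄(n) = 1`: (i) `h₈(n) ≡ (d(n)−1)/4 (mod 2)`
  ⟺ (ii) rank `0` ∧ `Ш[2^∞] ≃ (ℤ/2)²`) and Thm. 2 (p0003 L47–L62; `Ш[2^∞] ≃ (ℤ/2)^{2k}`) are recorded
  ROW-ONLY (their memberships need the `8`-rank / the genus divisors `d₁, d₂`; typable on request).

## What is typed, the `p = 2` flag, and the door to BSD

ONLY the second part of Theorem 3, (i) ⟺ (ii) ⟺ (iii), with `δ_p` rendered by the printed condition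
(1) (`IsDeltaOne p : ∃ u v, p = u² + 8v² ∧ v odd`; the representation of a prime `p ≡ 1 (mod 8)` by
`u² + 8v²` is unique up to signs, so (1) is a well-posed, DECIDABLE predicate on `p`), `h₄(n) = 1` as
`#(𝒜[2] ∩ 2𝒜) = 2` (`Tian2014.fourTwoCard … = 2`, the tree's rendering of the `4`-rank) and
`h₈(n) = 0` as `#(𝒜[2] ∩ 4𝒜) = 1` (`eightTwoCard … = 1`; for a finite abelian group
`rank_{𝔽₂} 2^{i−1}𝒜/2^i𝒜 = dim_{𝔽₂}(𝒜[2] ∩ 2^{i−1}𝒜)` = the number of cyclic `2`-power factors of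
order `≥ 2^i`). The statement is ALGEBRAIC and AT `2`: rank `0` and the full `2`-primary part of `Ш`.
It does NOT by itself mention `L(E_n, 1)`; but `E_n` has CM by `ℤ[i]` and the tree holds the glue
`bsdTriple_of_hasCM_of_mordellWeilRank_eq_zero_of_finite_shaPrimary` (Burungale–Tian, Ann. of Math.
203 (2026) Thm. 1.1 — the rank-zero `2`-converse — + Deuring–Hecke + Burungale–Flach, Camb. J. Math.
12 (2024) Thm. 1.1 / Cor. 2, all as named facts, file `BSDSelmerCMPConverseBSDTripleProofs`, whose
docstring names Wang's Thms. 1–2 as the intended input), so (iii) yields RANK ∧ SHAFIN ∧ LEAD for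
`congruentNumberCurve n` with `#Ш(E_n)[2^∞] = 4`: `bsdTriple_of_thm3` below (the cell's door
"D-CM-3", journal tier throughout). Membership of the family is decidable per `n` (all `p ∣ n` are
`≡ 1 (mod 8)`; `h₄(n) = 1` by a Rédei matrix, equivalently — as printed — `s(n) = 2` by Monsky's
matrix `HeathBrown1994.monskyMatrixOdd`; `δ_n` odd by one representation `p = u² + 8v²` per prime).

## Transcription (tree dictionary)

* `E_n` = `congruentNumberCurve n` (literally `y² = x³ − n²x`); rank = `mordellWeilRank`; `Ш` =
  `WeierstrassCurve.sha`, its `2`-primary part `AddCommGroup.primaryComponent _ 2`;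
  "`≃ (ℤ/2ℤ)²`" = an additive equivalence with `ZMod 2 × ZMod 2` (`Nonempty (_ ≃+ _)`).
* "`K = ℚ(√−n)`, `𝒜_n` its class group": any number field `K` with `[K:ℚ] = 2` containing a square root
  of `−n` (`Tian2014.IsQuadraticFieldOfSqrt K (−n)`), `ClassGroup (𝓞 K)` (multiplicative notation:
  `2𝒜 = squares`, `4𝒜 = fourth powers`, `𝒜[2] = {a | a² = 1}`).
* "all prime factors congruent to `1 (mod 8)`": `∀ p ∈ n.primeFactors, p % 8 = 1`; `δ_n` =
  `deltaCount n` = `#{p ∈ n.primeFactors | IsDeltaOne p}`; "(i) `2 ∤ δ_n`" = `Odd (deltaCount n)`.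
No `_holds` expected (Cassels pairing on `Sel₂/E[2]`, Gauss genus theory, Rédei matrices, quartic
symbols). Consumers take `(h : thm3_rank_zero_and_sha_two_by_two)`.

## References
* [Wang2016CongruentSha] Z. Wang, Sci. China Math. 59 (2016) 2145–2166 = arXiv:1511.03810: Thm. 1
  (p0003 L18–L23), Thm. 2 (p0003 L47–L62), Thm. 3 (p0011 L107–L131), §2.1 Monsky matrix (p0004), the
  remark `s₂(n) = 2 ⟺ h₄(n) = 1` (p0003 L31–L33).
* [BurungaleTian2026] Ann. of Math. (2) 203 (2026), Thm. 1.1; [BurungaleFlach2024] Camb. J. Math. 12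
  (2024), Thm. 1.1, Cor. 2, Cor. 3 — via the tree glue `bsdTriple_of_hasCM_of_mordellWeilRank_eq_zero_of_finite_shaPrimary`.
* [Tian2014] (vocabulary `fourTwoCard`, `IsQuadraticFieldOfSqrt`).
-/

noncomputable section

open scoped Classical

open NumberField WeierstrassCurve Literature.NumberTheory.EllipticCurves

namespace Literature.NumberTheory.EllipticCurves.Wang2016

/-! ### §1. Vocabulary (definitions with bodies; nothing asserted) -/

/-- `#(𝒜[2] ∩ 4𝒜)` for a (multiplicatively written) abelian group `𝒜`: the number of fourth powers of
order dividing `2`; equals `2^{h₈}` with `h₈ = rank_{𝔽₂} 4𝒜/8𝒜` the printed `8`-rank (for a finite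
abelian group both count the cyclic `2`-power factors of order `≥ 8`). "`h₈(n) = 0`" is
`eightTwoCard (Cl(ℚ(√−n))) = 1`. [cite: Wang2016CongruentSha, §1 (arXiv:1511.03810 p0003 L12–L14, definition of h_{2^i}(n)); Thm. 3 (ii) (p0011 L129)] -/
def eightTwoCard (A : Type*) [CommGroup A] : ℕ :=
  Nat.card {a : A // (∃ b : A, b ^ 4 = a) ∧ a ^ 2 = 1}

/-- Unfolding of `eightTwoCard` (by definition). [cite: Wang2016CongruentSha, §1 (arXiv p0003 L12–L14)] -/
theorem eightTwoCard_def (A : Type*) [CommGroup A] :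
    eightTwoCard A = Nat.card {a : A // (∃ b : A, b ^ 4 = a) ∧ a ^ 2 = 1} := rfl

/-- Wang's `δ_p = 1` for a prime `p ≡ 1 (mod 8)`, in the printed form (1) of Thm. 3: writing
`p = u² + 8v²` (positive integers; unique up to signs), `2 ∤ v`. A decidable arithmetic predicate.
[cite: Wang2016CongruentSha, Thm. 3 (1) (arXiv:1511.03810 p0011 L107–L111)] -/
def IsDeltaOne (p : ℕ) : Prop :=
  ∃ u v : ℕ, p = u ^ 2 + 8 * v ^ 2 ∧ Odd v

/-- `δ_n := Σ_{p ∣ n} δ_p` = the number of prime factors `p` of `n` with `δ_p = 1`.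
[cite: Wang2016CongruentSha, Thm. 3 (i) (arXiv:1511.03810 p0011 L127)] -/
def deltaCount (n : ℕ) : ℕ :=
  (n.primeFactors.filter IsDeltaOne).card

/-- Unfolding of `deltaCount` (by definition). [cite: Wang2016CongruentSha, Thm. 3 (i) (arXiv p0011 L127)] -/
theorem deltaCount_def (n : ℕ) : deltaCount n = (n.primeFactors.filter IsDeltaOne).card := rfl

/-! ### §2. The named fact: Wang 2016, Theorem 3 (second part) -/

/-- **Wang 2016, Theorem 3 (second part)** (verbatim in the module docstring): for `n` square-free
positive with ALL prime factors `≡ 1 (mod 8)` and `h₄(n) = 1` (`#(𝒜[2] ∩ 2𝒜) = 2` for the class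
group `𝒜` of `ℚ(√−n)`, read in any quadratic field `K ∋ √−n`), the following are equivalent:
(i) `δ_n = #{p ∣ n : δ_p = 1}` is odd (`δ_p = 1` ⟺ `p = u² + 8v²` with `v` odd);
(ii) `h₈(n) = 0` (`#(𝒜[2] ∩ 4𝒜) = 1`); (iii) `rank_ℤ E_n(ℚ) = 0` and `Ш(E_n/ℚ)[2^∞] ≃ (ℤ/2ℤ)²`.
Typed as the two equivalences (i) ⟺ (ii) and (i) ⟺ (iii). A THEOREM in print (JOURNAL), vendored
as a named fact; an algebraic statement at the prime `2` (rank and the whole `2`-primary part of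
`Ш`); no `_holds` expected.
[cite: Wang2016CongruentSha, Thm. 3 (arXiv:1511.03810 p0011 L107–L131); §1 p0003 L12–L14 (h_{2^i}); p0003 L31–L33 (s₂(n) = 2 ⟺ h₄(n) = 1)] -/
def thm3_rank_zero_and_sha_two_by_two : Prop :=
  ∀ (n : ℕ), Squarefree n → (∀ p ∈ n.primeFactors, p % 8 = 1) →
    ∀ (K : Type) [Field K] [NumberField K], Tian2014.IsQuadraticFieldOfSqrt K (-(n : ℤ)) →
      Tian2014.fourTwoCard (ClassGroup (𝓞 K)) = 2 →
        (Odd (deltaCount n) ↔ eightTwoCard (ClassGroup (𝓞 K)) = 1) ∧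
        (Odd (deltaCount n) ↔
          ((congruentNumberCurve n).mordellWeilRank = 0 ∧
            Nonempty (AddCommGroup.primaryComponent (congruentNumberCurve n).sha 2 ≃+
              (ZMod 2 × ZMod 2))))

/-! ### §3. Consequences PROVED (bookkeeping; instances discharged; the door D-CM-3) -/

/-- `(ℤ/2)²` has four elements. [folklore] -/
private theorem natCard_zmod_two_prod : Nat.card (ZMod 2 × ZMod 2) = 4 := by
  rw [Nat.card_prod, Nat.card_zmod]

/-- **Thm. 3 (i) ⟹ (iii), instances discharged**: on Wang's family with `δ_n` odd, `E_n` has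
Mordell–Weil rank `0` and `Ш(E_n/ℚ)[2^∞]` is finite of order `4` (indeed `≃ (ℤ/2)²`).
[cite: Wang2016CongruentSha, Thm. 3 (arXiv:1511.03810 p0011 L125–L131)] -/
theorem rank_zero_and_card_shaTwo_of_thm3 (h : thm3_rank_zero_and_sha_two_by_two) {n : ℕ}
    (hsq : Squarefree n) (h8 : ∀ p ∈ n.primeFactors, p % 8 = 1) (K : Type) [Field K]
    [NumberField K] (hK : Tian2014.IsQuadraticFieldOfSqrt K (-(n : ℤ)))
    (h4 : Tian2014.fourTwoCard (ClassGroup (𝓞 K)) = 2) (hδ : Odd (deltaCount n)) :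
    (congruentNumberCurve n).mordellWeilRank = 0 ∧
      Finite (AddCommGroup.primaryComponent (congruentNumberCurve n).sha 2) ∧
      Nat.card (AddCommGroup.primaryComponent (congruentNumberCurve n).sha 2) = 4 := by
  obtain ⟨hr, ⟨e⟩⟩ := ((h n hsq h8 K hK h4).2).mp hδ
  refine ⟨hr, Finite.of_equiv _ e.toEquiv.symm, ?_⟩
  rw [Nat.card_congr e.toEquiv, natCard_zmod_two_prod]

/-- **The door D-CM-3** (lead L1-6 / M-C3): Wang 2016 Thm. 3 + Burungale–Tian 2026 Thm. 1.1 +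
Deuring–Hecke + Burungale–Flach 2024 Cor. 2 — all as the tree's named facts, explicit binders — give
the FULL BSD formula (RANK ∧ SHAFIN ∧ LEAD, `BSDTriple`) for `congruentNumberCurve n` on Wang's family
{`n` square-free, all `p ∣ n` `≡ 1 (mod 8)`, `h₄(n) = 1`, `δ_n` odd}, together with rank `0` and
`#Ш(E_n)[2^∞] = 4`; via the tree glue `bsdTriple_of_hasCM_of_mordellWeilRank_eq_zero_of_finite_shaPrimary`
at `p = 2` (`E_n` has CM by `ℤ[i]`: `LiLiuTian2024.hasCM_congruentNumberCurve`). Nothing asserted.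
[cite: Wang2016CongruentSha, Thm. 3 (arXiv:1511.03810 p0011 L125–L131)]
[cite: BurungaleTian2026, Thm. 1.1] [cite: BurungaleFlach2024, Thm. 1.1 and Cor. 2] -/
theorem bsdTriple_of_thm3 (h : thm3_rank_zero_and_sha_two_by_two)
    (hBT : burungaleTian_analyticRank_eq_zero_of_selmerCorank_eq_zero_of_hasCM)
    (hH : hasEntireLFunction_of_j_mem_maximalCMJInvariants)
    (hBF : bsdTriple_of_hasCM_of_L_one_ne_zero) {n : ℕ} (hsq : Squarefree n)
    (h8 : ∀ p ∈ n.primeFactors, p % 8 = 1) (K : Type) [Field K] [NumberField K]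
    (hK : Tian2014.IsQuadraticFieldOfSqrt K (-(n : ℤ)))
    (h4 : Tian2014.fourTwoCard (ClassGroup (𝓞 K)) = 2) (hδ : Odd (deltaCount n)) :
    haveI := isElliptic_congruentNumberCurve (Squarefree.ne_zero hsq)
    haveI := isGloballyMinimal_congruentNumberCurve hsq
    (congruentNumberCurve n).BSDTriple ∧ (congruentNumberCurve n).mordellWeilRank = 0 ∧
      Nat.card (AddCommGroup.primaryComponent (congruentNumberCurve n).sha 2) = 4 := by
  haveI := isElliptic_congruentNumberCurve (Squarefree.ne_zero hsq)
  haveI := isGloballyMinimal_congruentNumberCurve hsq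
  obtain ⟨hr, hfin, hcard⟩ := rank_zero_and_card_shaTwo_of_thm3 h hsq h8 K hK h4 hδ
  haveI := hfin
  exact ⟨bsdTriple_of_hasCM_of_mordellWeilRank_eq_zero_of_finite_shaPrimary hBT hH hBF
    (congruentNumberCurve n) (LiLiuTian2024.hasCM_congruentNumberCurve n) 2 hr hfin, hr, hcard⟩

/-- **`BSD(E_n, ℓ)` for every prime `ℓ` on Wang's family** (Miller's `BSDp`; in particular `ℓ = 2`,
where `#Ш(E_n)[2^∞] = 4` is the non-trivial `2`-part), via the tree's `forall_bsdp_of_bsdTriple'`.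
[cite: Wang2016CongruentSha, Thm. 3] [cite: BurungaleTian2026, Thm. 1.1]
[cite: BurungaleFlach2024, Thm. 1.1 and Cor. 2] [cite: Miller2011LMS, §1 and Def. 1.1] -/
theorem forall_bsdp_of_thm3 (h : thm3_rank_zero_and_sha_two_by_two)
    (hBT : burungaleTian_analyticRank_eq_zero_of_selmerCorank_eq_zero_of_hasCM)
    (hH : hasEntireLFunction_of_j_mem_maximalCMJInvariants)
    (hBF : bsdTriple_of_hasCM_of_L_one_ne_zero) {n : ℕ} (hsq : Squarefree n)
    (h8 : ∀ p ∈ n.primeFactors, p % 8 = 1) (K : Type) [Field K] [NumberField K]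
    (hK : Tian2014.IsQuadraticFieldOfSqrt K (-(n : ℤ)))
    (h4 : Tian2014.fourTwoCard (ClassGroup (𝓞 K)) = 2) (hδ : Odd (deltaCount n))
    (ℓ : ℕ) (hℓ : ℓ.Prime) :
    haveI := isElliptic_congruentNumberCurve (Squarefree.ne_zero hsq)
    haveI := isGloballyMinimal_congruentNumberCurve hsq
    BSDp (congruentNumberCurve n) ℓ :=
  haveI := isElliptic_congruentNumberCurve (Squarefree.ne_zero hsq)
  haveI := isGloballyMinimal_congruentNumberCurve hsq
  forall_bsdp_of_bsdTriple' _ (bsdTriple_of_thm3 h hBT hH hBF hsq h8 K hK h4 hδ).1 ℓ hℓ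

end Literature.NumberTheory.EllipticCurves.Wang2016

end
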